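import Summits.CriticalPhenomena.PercolationContinuityZ3.Theorems.PercNearOneGluingNoHeavyLowerTailStarSetWordDesignations
import Summits.CriticalPhenomena.PercolationContinuityZ3.Theorems.PercNearOneGluingNoHeavyLowerTailStarSetWordCaps
import Summits.CriticalPhenomena.PercolationContinuityZ3.Theorems.PercNearOneGluingNoHeavyLowerTailStarSetOmegaCliques
import HarnessLib

/-!
# `NoHeavyLowerTail` (stmt-CriticalPhenomena-4575) — the pool words of the residual bound are class-words, II (blueprint §G4)

Support file (prover `prim-gen-swap` gen 15; `--supports stmt-CriticalPhenomena-4575`).  No definitions, no named facts, no sorries.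

The explicit pool words of `StarSet.residual_pool_inst` are bounded by the capacities `C_T` of their class-sets: the SELF words
`(X→e, J→s, dom X ē→ē)` of the group entries by `C_{{X, J, dom X ē}}`, the SELF′ words `(X→ē, J→s, I₀→q₀)` of the flagged entries by
`C_{{X, J, I₀}}`, the SELF_I words `(X→a, I₀→q₀, dom X a→u)` of the `I₀`-hubs by `C_{{X, I₀, dom X a}}` and the CROSS_I words
`(X→a_X, Y→a_Y, I₀→q₀)` by `C_{{X, Y, I₀}}` — each designation is valid (`one_word_le_cap`) and each word map is injective into class-sets.

* `StarSet.pool_words_selfI_le`, `StarSet.pool_words_crossI_le` (the `I₀`-group; part I has `StarSet.pool_words_self_le`).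
-/

namespace Summit.CriticalPhenomena.PercolationContinuityZ3.Theorems

open Finset
open scoped BigOperators Classical

namespace StarSet

variable {ι V : Type*} [Fintype ι] [LinearOrder ι] [DecidableEq V]

/-- **SELF_I words of the `I₀`-hubs are bounded by the capacities of their class-sets `{X, I₀, dom X a}`.** -/
theorem pool_words_selfI_le (P P' : ι → V) (hPP' : ∀ X, P X ≠ P' X) (r : V) (F : Finset ι)
    (O : ι → V → ℝ) (hO0 : ∀ X d, 0 ≤ O X d) (dom : ι → V → ι)
    (hdom : ∀ X ∉ F, ∀ d, (P X = d ∨ P' X = d) →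
      dom X d ∈ F ∧ (P (dom X d) = d ∨ P' (dom X d) = d) ∧
        (∀ u, (P (dom X d) = u ∨ P' (dom X d) = u) → (P X = u ∨ P' X = u) → u = d))
    (I₀ : ι)
    (UI : Finset (Finset ι × ι))
    (hUI : ∀ u ∈ UI, u.2 ∉ F ∧ (P u.2 ≠ r ∧ P' u.2 ≠ r) ∧ (P u.2 = P I₀ ∨ P' u.2 = P I₀) ∧ I₀ ∈ F ∧ P' I₀ = r ∧
      (P (dom u.2 (if P u.2 = P I₀ then P' u.2 else P u.2)) ≠ r ∧ P' (dom u.2 (if P u.2 = P I₀ then P' u.2 else P u.2)) ≠ r)) :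
    ∑ X ∈ UI.image Prod.snd, (O X (if P X = P I₀ then P' X else P X) * O I₀ (P I₀) * O (dom X (if P X = P I₀ then P' X
          else P X)) (if P (dom X (if P X = P I₀ then P' X else P X)) = (if P X = P I₀ then P' X else P X) then P' (dom X (if P X = P I₀
          then P' X else P X)) else P (dom X (if P X = P I₀ then P' X else P X)))) ≤
      ∑ T ∈ UI.image (fun u => ({u.2, I₀, dom u.2 (if P u.2 = P I₀ then P' u.2 else P u.2)} : Finset ι)), (∑ δ ∈ (univ : Finset (ι
            → Bool)).filter (fun δ => (∀ K ∉ T, δ K = false) ∧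
            3 ≤ (T.image fun K => if δ K then P K else P' K).card ∧ r ∉ T.image fun K => if δ K then P K else P' K),
          ∏ K ∈ T, O K (if δ K then P K else P' K)) := by
  set aI : ι → V := fun X => (if P X = P I₀ then P' X else P X) with haI
  set Dh : ι → ι := fun X => dom X (if P X = P I₀ then P' X else P X) with hDh
  set uI : ι → V := fun X => (if P (dom X (if P X = P I₀ then P' X else P X)) = (if P X = P I₀ then P' X else P X) then P' (dom X (if P X = P I₀ then P' X else P X)) else P (dom X (if P X = P I₀ then P' X else P X))) with huI
  set C : Finset ι → ℝ := fun T => ∑ δ ∈ (univ : Finset (ι → Bool)).filter (fun δ => (∀ K ∉ T, δ K = false) ∧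
      3 ≤ (T.image fun K => if δ K then P K else P' K).card ∧ r ∉ T.image fun K => if δ K then P K else P' K),
    ∏ K ∈ T, O K (if δ K then P K else P' K) with hC
  have hC0 : ∀ T, 0 ≤ C T := fun T => sum_nonneg fun δ _ => prod_nonneg fun K _ => hO0 _ _
  set H : Finset ι := UI.image Prod.snd with hH
  have hHf : ∀ X ∈ H, X ∉ F ∧ (P X ≠ r ∧ P' X ≠ r) ∧ (P X = P I₀ ∨ P' X = P I₀) ∧ I₀ ∈ F ∧ P' I₀ = r ∧
      (P (Dh X) ≠ r ∧ P' (Dh X) ≠ r) := by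
    intro X hX
    obtain ⟨u, hu, rfl⟩ := mem_image.1 hX
    exact hUI u hu
  have haI_spec : ∀ X, (P X = P I₀ ∨ P' X = P I₀) → (P X = aI X ∨ P' X = aI X) ∧ aI X ≠ P I₀ ∧
      ((P X = P I₀ ∧ P' X = aI X) ∨ (P X = aI X ∧ P' X = P I₀)) := by
    intro X hXq
    simp only [haI]
    by_cases h : P X = P I₀
    · rw [if_pos h]; exact ⟨Or.inr rfl, fun h' => hPP' X (h.trans h'.symm), Or.inl ⟨h, rfl⟩⟩
    · rw [if_neg h]; exact ⟨Or.inl rfl, h, Or.inr ⟨rfl, hXq.resolve_left h⟩⟩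
  have huI_spec : ∀ X, X ∉ F → (P X = P I₀ ∨ P' X = P I₀) →
      Dh X ∈ F ∧ (P (Dh X) = uI X ∨ P' (Dh X) = uI X) ∧ uI X ≠ aI X ∧ ¬ (P X = uI X ∨ P' X = uI X) := by
    intro X hXF hXq
    obtain ⟨haX, -, -⟩ := haI_spec X hXq
    obtain ⟨hDF, hDa, hDother⟩ := hdom X hXF (aI X) haX
    have hDh' : Dh X = dom X (aI X) := rfl
    rw [hDh']
    have hu : (P (dom X (aI X)) = uI X ∨ P' (dom X (aI X)) = uI X) ∧ uI X ≠ aI X := by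
      simp only [huI]
      by_cases h : P (dom X (aI X)) = aI X
      · rw [if_pos h]; exact ⟨Or.inr rfl, fun h' => hPP' _ (h.trans h'.symm)⟩
      · rw [if_neg h]; exact ⟨Or.inl rfl, h⟩
    exact ⟨hDF, hu.1, hu.2, fun hXu => hu.2 (hDother (uI X) hu.1 hXu)⟩
  have hport_r : ∀ (K : ι) (x : V), (P K ≠ r ∧ P' K ≠ r) → (P K = x ∨ P' K = x) → x ≠ r := by
    rintro K x hK (h | h)
    · rw [← h]; exact hK.1
    · rw [← h]; exact hK.2
  have hword : ∀ X ∈ H, O X (aI X) * O I₀ (P I₀) * O (Dh X) (uI X) ≤ C ({X, I₀, Dh X} : Finset ι) := by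
    intro X hX
    obtain ⟨hXF, hXr, hXq, hIF, hIr, hDr⟩ := hHf X hX
    obtain ⟨haX, haq, -⟩ := haI_spec X hXq
    obtain ⟨hDF, hDu, hua, hXu⟩ := huI_spec X hXF hXq
    have hqr : P I₀ ≠ r := fun h => hPP' I₀ (h.trans hIr.symm)
    have hqu : P I₀ ≠ uI X := fun h => hXu (by rw [← h]; exact hXq)
    have hXI : X ≠ I₀ := fun h => hXF (h ▸ hIF)
    have hXD : X ≠ Dh X := fun h => hXF (h ▸ hDF)
    have hID : I₀ ≠ Dh X := fun h => hDr.2 (h ▸ hIr)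
    exact one_word_le_cap P P' r O hO0 hXI hXD hID haX (Or.inl rfl) hDu haq hua.symm hqu (hport_r _ _ hXr haX) hqr
      (hport_r _ _ hDr hDu)
  have hinjT : Set.InjOn (fun X => ({X, I₀, Dh X} : Finset ι)) ↑H := by
    intro X hX Y hY h
    dsimp only at h
    obtain ⟨hXF, -⟩ := hHf X hX
    obtain ⟨hYF, -, hYq, hIF, -⟩ := hHf Y hY
    have hDF := (huI_spec Y hYF hYq).1
    have : X ∈ ({Y, I₀, Dh Y} : Finset ι) := by rw [← h]; exact mem_insert_self _ _
    rcases mem_insert.1 this with h' | h'; · exact h'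
    rcases mem_insert.1 h' with h' | h'; · exact absurd (h' ▸ hIF) hXF
    exact absurd ((mem_singleton.1 h') ▸ hDF) hXF
  calc ∑ X ∈ H, O X (aI X) * O I₀ (P I₀) * O (Dh X) (uI X) ≤ ∑ X ∈ H, C ({X, I₀, Dh X} : Finset ι) := sum_le_sum hword
    _ = ∑ T ∈ H.image (fun X => ({X, I₀, Dh X} : Finset ι)), C T := (sum_image hinjT).symm
    _ ≤ _ := by
      refine sum_le_sum_of_subset_of_nonneg (fun T hT => ?_) fun T _ _ => hC0 T
      obtain ⟨X, hX, rfl⟩ := mem_image.1 hT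
      obtain ⟨u, hu, rfl⟩ := mem_image.1 hX
      exact mem_image.2 ⟨u, hu, rfl⟩

/-- **CROSS_I words of the pairs of `I₀`-hubs are bounded by the capacities of their class-sets `{X, Y, I₀}`.** -/
theorem pool_words_crossI_le (P P' : ι → V) (hPP' : ∀ X, P X ≠ P' X)
    (hinj : Function.Injective fun X => (s(P X, P' X) : Sym2 V)) (r : V) (F : Finset ι)
    (O : ι → V → ℝ) (hO0 : ∀ X d, 0 ≤ O X d) (dom : ι → V → ι)
    (hdom : ∀ X ∉ F, ∀ d, (P X = d ∨ P' X = d) →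
      dom X d ∈ F ∧ (P (dom X d) = d ∨ P' (dom X d) = d) ∧
        (∀ u, (P (dom X d) = u ∨ P' (dom X d) = u) → (P X = u ∨ P' X = u) → u = d))
    (I₀ : ι)
    (UI : Finset (Finset ι × ι))
    (hUI : ∀ u ∈ UI, u.2 ∉ F ∧ (P u.2 ≠ r ∧ P' u.2 ≠ r) ∧ (P u.2 = P I₀ ∨ P' u.2 = P I₀) ∧ I₀ ∈ F ∧ P' I₀ = r ∧
      (P (dom u.2 (if P u.2 = P I₀ then P' u.2 else P u.2)) ≠ r ∧ P' (dom u.2 (if P u.2 = P I₀ then P' u.2 else P u.2)) ≠ r)) :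
    ∑ X ∈ UI.image Prod.snd, ∑ Y ∈ (UI.image Prod.snd).filter (fun Y => X < Y), (O X (if P X = P I₀ then P' X else P X) * O Y (if P Y = P I₀ then P' Y else P Y) * O I₀ (P I₀)) ≤
      ∑ T ∈ ((UI.image Prod.snd ×ˢ UI.image Prod.snd).filter (fun p => p.1 < p.2)).image
          (fun p => ({p.1, p.2, I₀} : Finset ι)), (∑ δ ∈ (univ : Finset (ι → Bool)).filter (fun δ => (∀ K ∉ T, δ K = false) ∧
            3 ≤ (T.image fun K => if δ K then P K else P' K).card ∧ r ∉ T.image fun K => if δ K then P K else P' K),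
          ∏ K ∈ T, O K (if δ K then P K else P' K)) := by
  set aI : ι → V := fun X => (if P X = P I₀ then P' X else P X) with haI
  set Dh : ι → ι := fun X => dom X (if P X = P I₀ then P' X else P X) with hDh
  set uI : ι → V := fun X => (if P (dom X (if P X = P I₀ then P' X else P X)) = (if P X = P I₀ then P' X else P X) then P' (dom X (if P X = P I₀ then P' X else P X)) else P (dom X (if P X = P I₀ then P' X else P X))) with huI
  set C : Finset ι → ℝ := fun T => ∑ δ ∈ (univ : Finset (ι → Bool)).filter (fun δ => (∀ K ∉ T, δ K = false) ∧
      3 ≤ (T.image fun K => if δ K then P K else P' K).card ∧ r ∉ T.image fun K => if δ K then P K else P' K),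
    ∏ K ∈ T, O K (if δ K then P K else P' K) with hC
  have hC0 : ∀ T, 0 ≤ C T := fun T => sum_nonneg fun δ _ => prod_nonneg fun K _ => hO0 _ _
  set H : Finset ι := UI.image Prod.snd with hH
  have hHf : ∀ X ∈ H, X ∉ F ∧ (P X ≠ r ∧ P' X ≠ r) ∧ (P X = P I₀ ∨ P' X = P I₀) ∧ I₀ ∈ F ∧ P' I₀ = r ∧
      (P (Dh X) ≠ r ∧ P' (Dh X) ≠ r) := by
    intro X hX
    obtain ⟨u, hu, rfl⟩ := mem_image.1 hX
    exact hUI u hu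
  have haI_spec : ∀ X, (P X = P I₀ ∨ P' X = P I₀) → (P X = aI X ∨ P' X = aI X) ∧ aI X ≠ P I₀ ∧
      ((P X = P I₀ ∧ P' X = aI X) ∨ (P X = aI X ∧ P' X = P I₀)) := by
    intro X hXq
    simp only [haI]
    by_cases h : P X = P I₀
    · rw [if_pos h]; exact ⟨Or.inr rfl, fun h' => hPP' X (h.trans h'.symm), Or.inl ⟨h, rfl⟩⟩
    · rw [if_neg h]; exact ⟨Or.inl rfl, h, Or.inr ⟨rfl, hXq.resolve_left h⟩⟩
  have huI_spec : ∀ X, X ∉ F → (P X = P I₀ ∨ P' X = P I₀) →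
      Dh X ∈ F ∧ (P (Dh X) = uI X ∨ P' (Dh X) = uI X) ∧ uI X ≠ aI X ∧ ¬ (P X = uI X ∨ P' X = uI X) := by
    intro X hXF hXq
    obtain ⟨haX, -, -⟩ := haI_spec X hXq
    obtain ⟨hDF, hDa, hDother⟩ := hdom X hXF (aI X) haX
    have hDh' : Dh X = dom X (aI X) := rfl
    rw [hDh']
    have hu : (P (dom X (aI X)) = uI X ∨ P' (dom X (aI X)) = uI X) ∧ uI X ≠ aI X := by
      simp only [huI]
      by_cases h : P (dom X (aI X)) = aI X
      · rw [if_pos h]; exact ⟨Or.inr rfl, fun h' => hPP' _ (h.trans h'.symm)⟩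
      · rw [if_neg h]; exact ⟨Or.inl rfl, h⟩
    exact ⟨hDF, hu.1, hu.2, fun hXu => hu.2 (hDother (uI X) hu.1 hXu)⟩
  have hport_r : ∀ (K : ι) (x : V), (P K ≠ r ∧ P' K ≠ r) → (P K = x ∨ P' K = x) → x ≠ r := by
    rintro K x hK (h | h)
    · rw [← h]; exact hK.1
    · rw [← h]; exact hK.2
  set R : Finset (ι × ι) := (H ×ˢ H).filter (fun p => p.1 < p.2) with hR
  have hsum : ∑ X ∈ H, ∑ Y ∈ H.filter (fun Y => X < Y), O X (aI X) * O Y (aI Y) * O I₀ (P I₀) =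
      ∑ p ∈ R, O p.1 (aI p.1) * O p.2 (aI p.2) * O I₀ (P I₀) :=
    (sum_finset_product (f := fun p : ι × ι => O p.1 (aI p.1) * O p.2 (aI p.2) * O I₀ (P I₀)) R H
      (fun X => H.filter (fun Y => X < Y)) (fun p => by
        simp only [hR, mem_filter, mem_product]; tauto)).symm
  have hword : ∀ p ∈ R, O p.1 (aI p.1) * O p.2 (aI p.2) * O I₀ (P I₀) ≤ C ({p.1, p.2, I₀} : Finset ι) := by
    intro p hp
    obtain ⟨hp, hlt⟩ := mem_filter.1 hp
    obtain ⟨hX, hY⟩ := mem_product.1 hp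
    obtain ⟨hXF, hXr, hXq, hIF, hIr, -⟩ := hHf _ hX
    obtain ⟨hYF, hYr, hYq, -, -, -⟩ := hHf _ hY
    obtain ⟨haX, haq, hXp⟩ := haI_spec _ hXq
    obtain ⟨haY, haq', hYp⟩ := haI_spec _ hYq
    have hqr : P I₀ ≠ r := fun h => hPP' I₀ (h.trans hIr.symm)
    have hXY : p.1 ≠ p.2 := ne_of_lt hlt
    have haa : aI p.1 ≠ aI p.2 := by
      intro h; apply hXY; apply hinj; simp only
      rcases hXp with ⟨h1, h2⟩ | ⟨h1, h2⟩ <;> rcases hYp with ⟨h3, h4⟩ | ⟨h3, h4⟩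
      · rw [h1, h2, h3, h4, h]
      · rw [h1, h2, h3, h4, h]; exact Sym2.eq_swap
      · rw [h1, h2, h3, h4, h]; exact Sym2.eq_swap
      · rw [h1, h2, h3, h4, h]
    have hXI : p.1 ≠ I₀ := fun h => hXF (h ▸ hIF)
    have hYI : p.2 ≠ I₀ := fun h => hYF (h ▸ hIF)
    exact one_word_le_cap P P' r O hO0 hXY hXI hYI haX haY (Or.inl rfl) haa haq haq' (hport_r _ _ hXr haX) (hport_r _ _ hYr haY) hqr
  have hinjT : Set.InjOn (fun p : ι × ι => ({p.1, p.2, I₀} : Finset ι)) ↑R := by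
    intro p hp p' hp' h
    dsimp only at h
    obtain ⟨hp, hlt⟩ := mem_filter.1 (mem_coe.1 hp)
    obtain ⟨hp', hlt'⟩ := mem_filter.1 (mem_coe.1 hp')
    obtain ⟨hX, hY⟩ := mem_product.1 hp
    obtain ⟨hX', hY'⟩ := mem_product.1 hp'
    have hIF := (hHf _ hX).2.2.2.1
    have hXI : p.1 ≠ I₀ := fun h' => (hHf _ hX).1 (h' ▸ hIF)
    have hYI : p.2 ≠ I₀ := fun h' => (hHf _ hY).1 (h' ▸ hIF)
    have hX'I : p'.1 ≠ I₀ := fun h' => (hHf _ hX').1 (h' ▸ hIF)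
    have hY'I : p'.2 ≠ I₀ := fun h' => (hHf _ hY').1 (h' ▸ hIF)
    have h1 : p.1 ∈ ({p'.1, p'.2, I₀} : Finset ι) := by rw [← h]; exact mem_insert_self _ _
    have h2 : p.2 ∈ ({p'.1, p'.2, I₀} : Finset ι) := by rw [← h]; exact mem_insert_of_mem (mem_insert_self _ _)
    have h1' : p'.1 ∈ ({p.1, p.2, I₀} : Finset ι) := by rw [h]; exact mem_insert_self _ _
    simp only [mem_insert, mem_singleton] at h1 h2 h1'
    rcases h1 with h1 | h1 | h1
    · rcases h2 with h2 | h2 | h2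
      · exact absurd (h1.trans h2.symm) (ne_of_lt hlt)
      · exact Prod.ext h1 h2
      · exact absurd h2 hYI
    · rcases h1' with h1' | h1' | h1'
      · exact absurd (h1'.trans h1) (ne_of_lt hlt')
      · rw [h1] at hlt; rw [h1'] at hlt'; exact absurd (lt_trans hlt hlt') (lt_irrefl _)
      · exact absurd h1' hX'I
    · exact absurd h1 hXI
  rw [hsum]
  calc ∑ p ∈ R, O p.1 (aI p.1) * O p.2 (aI p.2) * O I₀ (P I₀) ≤ ∑ p ∈ R, C ({p.1, p.2, I₀} : Finset ι) := sum_le_sum hword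
    _ = ∑ T ∈ R.image (fun p : ι × ι => ({p.1, p.2, I₀} : Finset ι)), C T := (sum_image hinjT).symm
    _ ≤ _ := le_of_eq rfl

end StarSet

end Summit.CriticalPhenomena.PercolationContinuityZ3.Theorems
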